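import Summits.AtomisticToContinuum.BoseEinsteinCondensation.Theorems.BECThomsonPrincipleGaussianDominationCanChordTransportFrom
import HarnessLib

/-!
# Line `coupling-monotone-chord` (crux `GaussianDominationCan`, stmt-AtomisticToContinuum-9479):
# the ray sign is EQUIVALENT to monotonicity of the sourced ground-state energy gain

Route `BECThomsonPrinciple`.  Supports (does not close) the crux item.  The registered open stub of the
line, `stub_sourceRaisesInteractionCore`, is a SIGN on the limiting interaction energy of near-minimisers
of the sourced functional (`groundInteraction`, a `⨆`/`⨅` gadget).  This file certifies that along the
coupling ray `τ ↦ τ • w` of a bounded admissible potential the sign is not an artefact of that gadget but an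
intrinsic property of the sourced ground-state ENERGY `e(s, τ) = inf_Φ F_{τ•w, s}(Φ)`:

* `ray_sign_of_gain_monotone` (abstract, converse of the landed Dini step `ray_dini`): if the gain
  `τ' ↦ e(s, τ') − e(0, τ')` does not decrease immediately to the right of `τ`, then the source does not
  lower the limiting near-minimiser interaction at `τ` (`⨆_δ g(0,δ,τ) ≤ ⨆_δ g(s,δ,τ)`);
* `ray_gain_le_of_sign` (abstract, interval form of the landed `ray_transport`): the sign on `[τ₁, τ₂)`
  gives `gain(τ₁) ≤ gain(τ₂)`;
* `raySign_iff_gain_monotoneOn` (concrete): for bounded admissible `w`, `L > 0`, `n ≠ 0`,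
  `(∀ τ ∈ (0,1), SourceRaisesInteractionAt (τ • w) m L n) ↔
   ∀ s ≥ 0, MonotoneOn (τ ↦ inf_Φ F_{τ•w,s} − inf_Φ F_{τ•w,0}) (0,1)`,
  i.e. the stub B (on rays) says exactly that the sourced ground-state energy has increasing differences
  in (coupling, source strength) — the "supermodularity form" of the crux's residue recorded on paper by
  leads c2/c4/c5 (`Cruxes/GaussianDominationCan/NOTES.md`), now kernel-checked.

Mechanism (variational Hellmann–Feynman, no spectral theory): the landed one-step bounds
`e(τ+h) ≤ e(τ) + δ + h·g(δ,τ)` (`ray_upper_step`) and `e(τ) + h·g(δ,τ) ≤ e(τ+h)` when `h·g ≤ δ`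
(`ray_lower_step`) of `…GaussianDominationCanChordTransport` §Ray; for the converse one uses the upper
step at source `s` with `δ = h²` and the lower step at source `0` with a FIXED level `δ'` chosen so that
`g(0,δ',τ)` is within a third of the gap of its supremum, and `h → 0⁺`.
Reference: W. Thirring, *Quantum Mathematical Physics* §3.5 (Feynman–Hellmann; concavity in linear
parameters).
-/

noncomputable section

namespace Summit.AtomisticToContinuum.BoseEinsteinCondensation.Cruxes.GaussianDominationCan.CouplingMonotoneChord

open MeasureTheory Set Filter Topology
open scoped ENNReal NNReal
open Literature.MathematicalPhysics.QuantumManyBody.BoseGas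
open Summit.AtomisticToContinuum.BoseEinsteinCondensation.Theorems.GaussianDominationCan.Negative
  (GDIneq sourceIntegral constState)

/-! ### §Ray: the converse Dini step and the interval form of the transport (abstract) -/

section Ray

variable {S : Type*} [Nonempty S] {t J : S → ℝ} {W : S → ℝ≥0∞} {Wm : ℝ} {F : ℝ → ℝ → S → ℝ}
  {e : ℝ → ℝ → ℝ} {g : ℝ → ℝ → ℝ → ℝ≥0∞} {b : ℝ → ℝ} {s' : ℝ}
  (hWle : ∀ Φ, W Φ ≤ ENNReal.ofReal Wm) (hWm : 0 ≤ Wm)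
  (hF : ∀ τ s' Φ, F τ s' Φ = t Φ + max τ 0 * (W Φ).toReal - s' * J Φ)
  (he : ∀ s' τ, e s' τ = ⨅ Φ, F τ s' Φ)
  (hg : ∀ s' δ τ, g s' δ τ = ⨅ (Φ : S) (_ : F τ s' Φ ≤ e s' τ + δ), W Φ)
  (hb : ∀ s' τ Φ, b s' ≤ F τ s' Φ)

include hWle hWm hF he hg hb

/-- **Converse Dini step.**  If the sourced gain `τ' ↦ e(s, τ') - e(0, τ')` does not drop below its
value at `τ` for `τ' > τ` close to `τ`, then the source does not lower the limiting near-minimiser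
interaction at `τ`: `⨆_δ g(0, δ, τ) ≤ ⨆_δ g(s, δ, τ)`.  (Upper step at source `s` with `δ = h²`, lower
step at source `0` with a fixed level `δ'`, `h → 0⁺`.) [folklore] -/
theorem ray_sign_of_gain_monotone {s τ : ℝ} (hτ : 0 ≤ τ)
    (hmono : ∀ᶠ z in 𝓝[>] τ, e s τ - e 0 τ ≤ e s z - e 0 z) :
    ⨆ (δ : ℝ) (_ : 0 < δ), g 0 δ τ ≤ ⨆ (δ : ℝ) (_ : 0 < δ), g s δ τ := by
  by_contra hlt
  push Not at hlt
  have hG0_ne : (⨆ (δ : ℝ) (_ : 0 < δ), g 0 δ τ) ≠ ⊤ :=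
    ne_top_of_le_ne_top ENNReal.ofReal_ne_top (iSup₂_le fun δ hδ => ray_g_le hWle he hg hδ)
  have hGs_ne : (⨆ (δ : ℝ) (_ : 0 < δ), g s δ τ) ≠ ⊤ := ne_top_of_le_ne_top hG0_ne hlt.le
  have hgap : (⨆ (δ : ℝ) (_ : 0 < δ), g s δ τ).toReal < (⨆ (δ : ℝ) (_ : 0 < δ), g 0 δ τ).toReal :=
    (ENNReal.toReal_lt_toReal hGs_ne hG0_ne).2 hlt
  set γ : ℝ := (⨆ (δ : ℝ) (_ : 0 < δ), g 0 δ τ).toReal - (⨆ (δ : ℝ) (_ : 0 < δ), g s δ τ).toReal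
    with hγ
  have hγpos : 0 < γ := by rw [hγ]; linarith
  -- a level `δ'` with `G(0, τ) - γ/3 ≤ g(0, δ', τ)`
  obtain ⟨δ', hδ', hg0⟩ : ∃ δ' : ℝ, 0 < δ' ∧
      (⨆ (δ : ℝ) (_ : 0 < δ), g 0 δ τ).toReal - γ / 3 ≤ (g 0 δ' τ).toReal := by
    have ha : 0 ≤ (⨆ (δ : ℝ) (_ : 0 < δ), g 0 δ τ).toReal - γ / 3 := by
      have := ENNReal.toReal_nonneg (a := ⨆ (δ : ℝ) (_ : 0 < δ), g s δ τ)
      rw [hγ]; linarith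
    obtain ⟨δ', hδ'⟩ := lt_iSup_iff.1
      ((ENNReal.ofReal_lt_iff_lt_toReal ha hG0_ne).2 (by linarith))
    obtain ⟨hpos, hlt'⟩ := lt_iSup_iff.1 hδ'
    have hgtop : g 0 δ' τ ≠ ⊤ :=
      ne_top_of_le_ne_top ENNReal.ofReal_ne_top (ray_g_le hWle he hg hpos)
    exact ⟨δ', hpos, ((ENNReal.ofReal_lt_iff_lt_toReal ha hgtop).1 hlt').le⟩
  have hg0_le : (g 0 δ' τ).toReal ≤ Wm :=
    ENNReal.toReal_le_of_le_ofReal hWm (ray_g_le hWle he hg hδ')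
  -- a point `z = τ + h` to the right of `τ` with `h < γ/3`, `h ≤ δ'/(Wmax+1)` and the monotonicity
  have hmem : Ioo τ (τ + min (γ / 3) (δ' / (Wm + 1))) ∈ 𝓝[>] τ :=
    Ioo_mem_nhdsGT (by
      have := lt_min (by positivity : 0 < γ / 3) (by positivity : 0 < δ' / (Wm + 1)); linarith)
  obtain ⟨z, hzmono, hz⟩ := (hmono.and (Filter.eventually_of_mem hmem fun z hz => hz)).exists
  have hh : 0 < z - τ := sub_pos.2 hz.1
  have hhγ : z - τ < γ / 3 := by linarith [min_le_left (γ / 3) (δ' / (Wm + 1)), hz.2]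
  have hhδ : z - τ ≤ δ' / (Wm + 1) := by linarith [min_le_right (γ / 3) (δ' / (Wm + 1)), hz.2]
  have hsmall : (z - τ) * (g 0 δ' τ).toReal ≤ δ' :=
    calc (z - τ) * (g 0 δ' τ).toReal ≤ δ' / (Wm + 1) * Wm :=
          mul_le_mul hhδ hg0_le ENNReal.toReal_nonneg (by positivity)
      _ ≤ δ' := by rw [div_mul_eq_mul_div, div_le_iff₀ (by positivity)]; nlinarith
  -- the two one-step bounds
  have up := ray_upper_step hWle hF he hg hb (s' := s) hτ hh (δ := (z - τ) ^ 2) (by positivity)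
  have low := ray_lower_step hWle hF he hg hb (s' := 0) hτ hh hsmall
  rw [show τ + (z - τ) = z by ring] at up low
  have hgs : (g s ((z - τ) ^ 2) τ).toReal ≤ (⨆ (δ : ℝ) (_ : 0 < δ), g s δ τ).toReal :=
    ENNReal.toReal_mono hGs_ne (le_iSup₂_of_le ((z - τ) ^ 2) (by positivity) le_rfl)
  -- contradiction: the gain drops by at least `h γ / 3` from `τ` to `z`
  nlinarith [mul_le_mul_of_nonneg_left hgs hh.le, mul_le_mul_of_nonneg_left hg0 hh.le,
    show (z - τ) ^ 2 < (z - τ) * (γ / 3) by nlinarith, mul_pos hh hγpos]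

/-- **Interval form of the transport.**  The sign `⨆_δ g(0,δ,τ) ≤ ⨆_δ g(s,δ,τ)` at every
`τ ∈ [τ₁, τ₂)`, `0 < τ₁ ≤ τ₂`, gives `e(0, τ₂) - e(s, τ₂) ≤ e(0, τ₁) - e(s, τ₁)`, i.e. the sourced gain
`e(s, ·) - e(0, ·)` does not decrease from `τ₁` to `τ₂` (continuity, the Dini step `ray_dini` and
`image_le_of_liminf_slope_right_le_deriv_boundary` with a constant bound). [folklore] -/
theorem ray_gain_le_of_sign {s τ₁ τ₂ : ℝ} (hτ₁ : 0 ≤ τ₁) (hτ₁₂ : τ₁ ≤ τ₂)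
    (hG : ∀ τ : ℝ, τ₁ ≤ τ → τ < τ₂ →
      ⨆ (δ : ℝ) (_ : 0 < δ), g 0 δ τ ≤ ⨆ (δ : ℝ) (_ : 0 < δ), g s δ τ) :
    e 0 τ₂ - e s τ₂ ≤ e 0 τ₁ - e s τ₁ := by
  have hcont : ContinuousOn (fun x => e 0 x - e s x) (Ici 0) :=
    (ray_continuousOn hWle hWm hF he hb 0).sub (ray_continuousOn hWle hWm hF he hb s)
  exact image_le_of_liminf_slope_right_le_deriv_boundary (f := fun x => e 0 x - e s x) (a := τ₁)
    (b := τ₂) (hcont.mono fun x hx => hτ₁.trans hx.1) (B := fun _ => e 0 τ₁ - e s τ₁)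
    (B' := fun _ => 0) le_rfl continuousOn_const
    (fun x _ => hasDerivWithinAt_const x (Ici x) (e 0 τ₁ - e s τ₁))
    (fun x hx _ hr => ray_dini hWle hWm hF he hg hb (hτ₁.trans hx.1) (hG x hx.1 hx.2) hr)
    (right_mem_Icc.2 hτ₁₂)

end Ray

/-! ### §Concrete: bounded admissible potentials -/

section Concrete

/-- **The ray sign is equivalent to monotonicity of the sourced ground-state energy gain** (line
`coupling-monotone-chord`, crux stmt-AtomisticToContinuum-9479).  For a bounded admissible `w`, `L > 0`,
`n ≠ 0`: the source never lowers the ground-state interaction energy at any interior ray point `τ • w`,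
`τ ∈ (0, 1)` (the registered stub B on the ray, `SourceRaisesInteractionAt`) if and only if for every
source strength `s ≥ 0` the sourced ground-state energy gain
`τ ↦ inf_Φ F_{τ•w, s}(Φ) - inf_Φ F_{τ•w, 0}(Φ)` is non-decreasing on `(0, 1)` — increasing differences
of the sourced ground-state energy in (coupling, source).  Forward: `ray_gain_le_of_sign`; backward:
`ray_sign_of_gain_monotone`; dictionary `groundInteraction (τ•w) s = τ ⨆_δ g(s, δ, τ)`
(`groundInteraction_scalePot_eq`), the free chord `stub_freeCase` bounding the sourced functional
below. [folklore] -/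
theorem raySign_iff_gain_monotoneOn :
    ∀ w : ℝ → ℝ≥0∞, IsRepulsiveFiniteRange w → (∃ B : ℝ, ∀ r, w r ≤ ENNReal.ofReal B) →
      ∀ m : ℕ, ∀ L : ℝ, 0 < L → ∀ n : Fin 3 → ℤ, n ≠ 0 →
        ((∀ τ : ℝ, 0 < τ → τ < 1 → SourceRaisesInteractionAt (scalePot τ w) m L n) ↔
          ∀ s : ℝ, 0 ≤ s → MonotoneOn
            (fun τ => (⨅ Φ : PeriodicTrialState (m + 1) L, sourcedFunctional (scalePot τ w) m L n s Φ) -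
              ⨅ Φ : PeriodicTrialState (m + 1) L, sourcedFunctional (scalePot τ w) m L n 0 Φ)
            (Set.Ioo 0 1)) := by
  intro w hw hB m L hL n hn
  have hc : ((Real.sqrt (L ^ 3))⁻¹) ^ 2 * L ^ 3 = 1 := by
    rw [inv_pow, Real.sq_sqrt (by positivity), inv_mul_cancel₀ (by positivity)]
  haveI : Nonempty (PeriodicTrialState (m + 1) L) := ⟨constState m hL _ hc⟩
  obtain ⟨Wm, hWm, hW⟩ := exists_interactionEnergy_le hw hB hL (m + 1)
  -- the real objects of the ray analysis
  set F : ℝ → ℝ → PeriodicTrialState (m + 1) L → ℝ :=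
    fun τ s' Φ => sourcedFunctional (scalePot τ w) m L n s' Φ with hFdef
  obtain ⟨e, he⟩ : ∃ e : ℝ → ℝ → ℝ, ∀ s' τ, e s' τ = ⨅ Φ, F τ s' Φ := ⟨_, fun _ _ => rfl⟩
  obtain ⟨g, hg⟩ : ∃ g : ℝ → ℝ → ℝ → ℝ≥0∞, ∀ s' δ τ, g s' δ τ =
      ⨅ (Φ : PeriodicTrialState (m + 1) L) (_ : F τ s' Φ ≤ e s' τ + δ), interactionEnergy w Φ :=
    ⟨_, fun _ _ _ => rfl⟩
  have hF : ∀ τ s' Φ, F τ s' Φ = (periodicEnergy 0 Φ).toReal + max τ 0 * (interactionEnergy w Φ).toReal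
      - s' * (2 * (m + 1) * ‖sourceIntegral m L n Φ.ψ‖) :=
    fun τ s' Φ => sourcedFunctional_scalePot hW τ s' Φ
  -- the lower bound from the free chord (sharp constant `1/(4π²)`, `stub_freeCase`)
  have hfree : GDChordBody 0 (1 / (4 * Real.pi ^ 2)) m L n := stub_freeCase m L hL n hn
  have hb : ∀ s' τ Φ, (periodicGroundStateEnergy 0 (m + 1) L).toReal -
      1 / (4 * Real.pi ^ 2) * s' ^ 2 * L ^ 2 / ‖(fun j => (n j : ℝ))‖ ^ 2 ≤ F τ s' Φ :=
    fun s' τ Φ => sourcedFunctional_ge_of_free hW (by positivity) hfree s' τ Φ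
  have hbdd : ∀ s' τ, BddBelow (Set.range fun Φ : PeriodicTrialState (m + 1) L =>
      sourcedFunctional (scalePot τ w) m L n s' Φ) :=
    fun s' τ => ⟨_, Set.forall_mem_range.2 (hb s' τ)⟩
  -- dictionary: the sign at `τ > 0` is `G(0, τ) ≤ G(s, τ)`
  have hdict : ∀ τ : ℝ, 0 < τ → ∀ s : ℝ,
      (groundInteraction (scalePot τ w) m L n 0 ≤ groundInteraction (scalePot τ w) m L n s ↔
        ⨆ (δ : ℝ) (_ : 0 < δ), g 0 δ τ ≤ ⨆ (δ : ℝ) (_ : 0 < δ), g s δ τ) := by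
    intro τ hτ s
    rw [groundInteraction_scalePot_eq hW hτ (he 0 τ) (hbdd 0 τ) fun δ => hg 0 δ τ,
      groundInteraction_scalePot_eq hW hτ (he s τ) (hbdd s τ) fun δ => hg s δ τ]
    exact ENNReal.mul_le_mul_iff_right (ENNReal.ofReal_pos.2 hτ).ne' ENNReal.ofReal_ne_top
  -- dictionary: the gain is `e(s, ·) - e(0, ·)`
  have hgain : ∀ s τ, (⨅ Φ : PeriodicTrialState (m + 1) L, sourcedFunctional (scalePot τ w) m L n s Φ) -
      (⨅ Φ : PeriodicTrialState (m + 1) L, sourcedFunctional (scalePot τ w) m L n 0 Φ) =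
      e s τ - e 0 τ := fun s τ => by rw [he, he]
  constructor
  · -- forward: the sign on `(0, 1)` gives monotone gains
    intro hsign s hs τ₁ hτ₁ τ₂ hτ₂ hτ₁₂
    simp only [hgain]
    have h := ray_gain_le_of_sign hW hWm hF he hg hb (s := s) hτ₁.1.le hτ₁₂ fun τ hτl hτr =>
      (hdict τ (hτ₁.1.trans_le hτl) s).1 (hsign τ (hτ₁.1.trans_le hτl) (hτr.trans hτ₂.2) s hs)
    linarith
  · -- backward: monotone gains give the sign at every interior ray point
    intro hmono τ hτ hτ1 s hs
    refine (hdict τ hτ s).2 (ray_sign_of_gain_monotone hW hWm hF he hg hb hτ.le ?_)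
    refine Filter.eventually_of_mem (Ioo_mem_nhdsGT hτ1) fun z hz => ?_
    have h := hmono s hs ⟨hτ, hτ1⟩ ⟨hτ.trans hz.1, hz.2⟩ hz.1.le
    simp only [hgain] at h
    exact h

end Concrete

end Summit.AtomisticToContinuum.BoseEinsteinCondensation.Cruxes.GaussianDominationCan.CouplingMonotoneChord

end
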